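import Mathlib

/-!
HONEST FRAMING: exact (Metropolis-corrected) sampling algorithms for lattice gauge theory; figures of
merit are autocorrelation/cost numbers at stated couplings and volumes; no continuum-physics claim.

# MapLocality — the exact light cone of composed finite-range field maps (THEORY-1.md §13.5)

Proposed tree path: `Summits/Ventures/LatticeQCDFlow/TrivializingMaps/MapLocality.lean` (OURS — venture
work, never `Literature/`). Cell `lqcd-flow` (pub-lqcd), unit `pub-lqcd-theory1-g4`, 2026-08-21.

## What is here (Mathlib only, everything PROVED, 0 sorries)
A field map `F : (ι → α) → (ι → α)` (links `ι`, link variables `α`) has **read-sets** `N : ι → Set ι` when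
its output at `i` depends only on the inputs in `N i` (Mathlib's `DependsOn`).  This is the situation of
every TRUNCATED trivializing map integrated with Lüscher's Euler scheme (Lüscher 2010 §5.1 eq. (5.1),
`Literature…Luscher2010.eulerStep`): one Euler step of the order-`N` generator reads the links within
plaquette-distance `N+1` of the updated link (finite-order locality, §4.5(b); THEORY-1 §10, §12.5).

* `DependsOn.comp_readSets` — composing two maps composes the read-sets: `(G ∘ F) · i` reads
  `⋃ j ∈ M i, N j`.
* `reach N n i` and `dependsOn_iterate_reach` — `n` iterations of `F` read exactly the `n`-step
  reachability set (the EXACT LIGHT CONE: no tails).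
* `reach_subset_ball` / `dependsOn_iterate_ball` — if every read-set sits in a ball of radius `R` for a
  distance-like `d` (only `d i i = 0` and the triangle inequality are used), `n` steps read the ball of
  radius `n * R`.
* `reachL`, `dependsOn_comp_list` / `…_ball` — the same for a composite of DIFFERENT maps (the patchwise /
  β-continued maps of THEORY-1 §13.3: ranges add).

Consequence used in THEORY-1 §13.5: a depth-`n` Euler-integrated truncated map of order `N` is a strictly
finite-range map of range `n (N+1)` in plaquette-distance; with the log-depth law of §12.5
(`N* = O(log V)`) the whole exact-up-to-ε map has range `O(n log V)` — a quantitative "footprint" statement,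
to be set against the lower bound "range ≳ correlation length" for any exact quasi-local trivialization
(§13.5, paper).  Continuous-time flows have exponential (Grönwall) cones instead; not treated here.
-/

namespace Summit.Ventures.LatticeQCDFlow.TrivializingMaps

open Set

variable {ι α : Type*}

/-- Composition composes read-sets: if `G · i` reads `M i` and `F · j` reads `N j`, then `(G ∘ F) · i`
reads `⋃ j ∈ M i, N j`. -/
theorem DependsOn.comp_readSets {F G : (ι → α) → (ι → α)} {M N : ι → Set ι}
    (hG : ∀ i, DependsOn (fun W => G W i) (M i)) (hF : ∀ j, DependsOn (fun W => F W j) (N j)) (i : ι) :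
    DependsOn (fun W => G (F W) i) (⋃ j ∈ M i, N j) := by
  intro W W' h
  apply hG i
  intro j hj
  apply hF j
  intro k hk
  exact h k (mem_iUnion₂.2 ⟨j, hj, hk⟩)

/-- The `n`-step reachability set of the read-set structure `N`: the inputs that can influence output `i`
after `n` iterations. -/
def reach (N : ι → Set ι) : ℕ → ι → Set ι
  | 0, i => {i}
  | n + 1, i => ⋃ j ∈ N i, reach N n j

/-- Zero steps read only the site itself. -/
@[simp] theorem reach_zero (N : ι → Set ι) (i : ι) : reach N 0 i = {i} := rfl

/-- One more step reads the reach-sets of the read-set. -/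
theorem reach_succ (N : ι → Set ι) (n : ℕ) (i : ι) : reach N (n + 1) i = ⋃ j ∈ N i, reach N n j := rfl

/-- **Exact light cone of an iterated finite-range map.**  If the output of `F` at every link `i` depends
only on the inputs in `N i`, then the output of `F^[n]` at `i` depends only on the inputs in `reach N n i`. -/
theorem dependsOn_iterate_reach {F : (ι → α) → (ι → α)} {N : ι → Set ι}
    (hF : ∀ i, DependsOn (fun W => F W i) (N i)) :
    ∀ (n : ℕ) (i : ι), DependsOn (fun W => F^[n] W i) (reach N n i) := by
  intro n
  induction n with
  | zero =>
    intro i W W' h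
    simpa using h i (mem_singleton i)
  | succ n ih =>
    intro i W W' h
    simp only [Function.iterate_succ_apply']
    exact DependsOn.comp_readSets (G := F) (F := fun W => F^[n] W) hF ih i h

/-- If every read-set lies in the `d`-ball of radius `R` (`d` with `d i i = 0` and the triangle inequality),
the `n`-step reachability set lies in the ball of radius `n * R`. -/
theorem reach_subset_ball {N : ι → Set ι} (d : ι → ι → ℕ) (hd0 : ∀ i, d i i = 0)
    (htri : ∀ a b c, d a c ≤ d a b + d b c) {R : ℕ} (hN : ∀ i, ∀ j ∈ N i, d i j ≤ R) :
    ∀ (n : ℕ) (i : ι), reach N n i ⊆ {k | d i k ≤ n * R} := by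
  intro n
  induction n with
  | zero =>
    intro i k hk
    simp only [reach_zero, mem_singleton_iff] at hk
    subst hk
    simp [hd0]
  | succ n ih =>
    intro i k hk
    simp only [reach_succ, mem_iUnion₂] at hk
    obtain ⟨j, hj, hk⟩ := hk
    have h1 := hN i j hj
    have h2 := ih j hk
    simp only [mem_setOf_eq] at h2 ⊢
    calc d i k ≤ d i j + d j k := htri i j k
      _ ≤ R + n * R := Nat.add_le_add h1 h2
      _ = (n + 1) * R := by ring

/-- **Range adds under iteration.**  `n` steps of a range-`R` map form a range-`n R` map. -/
theorem dependsOn_iterate_ball {F : (ι → α) → (ι → α)} {N : ι → Set ι}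
    (hF : ∀ i, DependsOn (fun W => F W i) (N i)) (d : ι → ι → ℕ) (hd0 : ∀ i, d i i = 0)
    (htri : ∀ a b c, d a c ≤ d a b + d b c) {R : ℕ} (hN : ∀ i, ∀ j ∈ N i, d i j ≤ R) (n : ℕ) (i : ι) :
    DependsOn (fun W => F^[n] W i) {k | d i k ≤ n * R} :=
  (dependsOn_iterate_reach hF n i).mono (reach_subset_ball d hd0 htri hN n i)

/-- Reachability set of a composite of different maps, listed OUTERMOST FIRST (`[N₁, N₂, …]` for
`F₁ ∘ F₂ ∘ …`). -/
def reachL : List (ι → Set ι) → ι → Set ι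
  | [], i => {i}
  | N :: Ns, i => ⋃ j ∈ N i, reachL Ns j

/-- The composite `F₁ ∘ F₂ ∘ ⋯ ∘ Fₘ` of maps with read-sets `N₁, …, Nₘ` (a list of pairs, outermost first)
reads `reachL [N₁, …, Nₘ]`. -/
theorem dependsOn_comp_list :
    ∀ (L : List (((ι → α) → (ι → α)) × (ι → Set ι))),
      (∀ p ∈ L, ∀ i, DependsOn (fun W => p.1 W i) (p.2 i)) →
      ∀ i, DependsOn (fun W => (L.map Prod.fst).foldr (fun F acc => F ∘ acc) id W i)
        (reachL (L.map Prod.snd) i) := by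
  intro L
  induction L with
  | nil =>
    intro _ i W W' h
    simpa [reachL] using h i (by simp [reachL])
  | cons p L ih =>
    intro hL i
    have hp : ∀ i, DependsOn (fun W => p.1 W i) (p.2 i) := hL p (by simp)
    have hrest := ih (fun q hq => hL q (by simp [hq]))
    simp only [List.map_cons, List.foldr_cons, reachL]
    exact DependsOn.comp_readSets (G := p.1) hp hrest i

/-- Ranges add under composition of different maps: if map `ℓ` has range `R ℓ`, the composite has range
`∑ R ℓ`. -/
theorem reachL_subset_ball (d : ι → ι → ℕ) (hd0 : ∀ i, d i i = 0)
    (htri : ∀ a b c, d a c ≤ d a b + d b c) :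
    ∀ (L : List ((ι → Set ι) × ℕ)), (∀ p ∈ L, ∀ i, ∀ j ∈ p.1 i, d i j ≤ p.2) →
      ∀ i, reachL (L.map Prod.fst) i ⊆ {k | d i k ≤ (L.map Prod.snd).sum} := by
  intro L
  induction L with
  | nil =>
    intro _ i k hk
    simp only [List.map_nil, reachL, mem_singleton_iff] at hk
    subst hk
    simp [hd0]
  | cons p L ih =>
    intro hL i k hk
    simp only [List.map_cons, reachL, mem_iUnion₂] at hk
    obtain ⟨j, hj, hk⟩ := hk
    have h1 : d i j ≤ p.2 := hL p (by simp) i j hj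
    have h2 := ih (fun q hq => hL q (by simp [hq])) j hk
    simp only [mem_setOf_eq, List.map_cons, List.sum_cons] at h2 ⊢
    calc d i k ≤ d i j + d j k := htri i j k
      _ ≤ p.2 + (L.map Prod.snd).sum := Nat.add_le_add h1 h2

end Summit.Ventures.LatticeQCDFlow.TrivializingMaps
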